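import Literature.Computability.AlgebraicComplexity.DawarWilsenach2025
import Mathlib.Combinatorics.SimpleGraph.Matching
import Mathlib.Combinatorics.SimpleGraph.Bipartite
import Mathlib.Combinatorics.SimpleGraph.AdjMatrix
import Mathlib.Algebra.BigOperators.Ring.Finset
import Mathlib.Algebra.BigOperators.GroupWithZero.Finset
import Literature.ModelTheory.FiniteModelTheory.SymmetricCircuitCountingWidth
import Literature.Probability.LatticeModels.PerfectMatchingCount
import HarnessLib

/-!
# Dawar–Wilsenach, Theorem 7.1: groundwork for the discharge (proved lemmas only)

Topic `Computability/AlgebraicComplexity`, namespace `Literature.Computability.AlgebraicComplexity`.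
Sibling proof file of `DawarWilsenach2025.lean` (the named fact `DawarWilsenach2025_thm71`,
A. Dawar, G. Wilsenach, *Symmetric Arithmetic Circuits*, Theory of Computing 21 (14) (2025) 1–32,
Thm. 7.1 p. 18). Everything here is PROVED; no new definitions, no named facts.

## The printed proof of Theorem 7.1 (pp. 13–19) and its status in the tree

"By Theorem 7.2, we have, for each `k`, a pair of graphs `X` and `Y` with `O(k)` vertices such
that `X ≡^k Y` and `μ(X) ≠ μ(Y)` and hence `μ(X)² ≠ μ(Y)²`. Thus, the counting width of `μ²` is
`Ω(n)`. Suppose that there is a family of square-symmetric arithmetic circuits over a field of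
characteristic `0` with orbit size `2^{o(n)}` computing `{PERM_n}`. Then, since the permanent of
the adjacency matrix of a bipartite graph is exactly `μ(Γ)²`, it follows from Corollary 6.5 that
the counting width of `μ²` is `o(n)`, giving a contradiction." (p. 19; `μ(Γ)` = number of perfect
matchings.) The ingredients:
* Thm. 5.1 (p. 13, orbit-size preserving translation of symmetric arithmetic circuits into
  symmetric threshold circuits) and Cor. 6.5 — not in the tree;
* Thm. 6.4 (orbit size `2^{o(n)}` ⇒ counting width `o(n)`) — in the tree as the (undischarged)
  named fact `Literature.ModelTheory.FiniteModelTheory.DawarWilsenach2025_orbitSize_countingWidth`;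
* Thm. 7.2 (Cai–Fürer–Immerman graphs with balance vertices and their perfect matchings,
  pp. 19–25) — not in the tree (the tree's `CFI.lean` is the standard construction).
So the discharge of `DawarWilsenach2025_thm71` is blocked on those; this file lands the parts of the
argument that are self-contained.

## Content (all proved)

* §3.2, remark after Def. 3.7 ("if a circuit is `Γ`-symmetric then it computes a `Γ`-symmetric
  polynomial"), for the UNBUNDLED notions used in the statement of Thm. 7.1
  (`LabelledArithCircuit.IsAutomorphismExtending`, `IsSymmetric`; the bundled
  `SymmetricArithmeticCircuit.eval_smul` exists): `IsAutomorphismExtending.eval_apply`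
  (`eval (π g) = rename γ (eval g)`), `IsSymmetric.eval_output_smul`,
  `IsSymmetric.rename_eval_output` (a `Γ`-fixed output computes a `Γ`-invariant polynomial), and
  the group-like closure of automorphisms (`isAutomorphismExtending_one`, `.inv`, `.trans`) with
  the resulting orbit API (`mem_autOrbit_self`, `mem_autOrbit_comm`, `one_le_orbitSize`,
  `IsSymmetric.exists_mem_autOrbit_eval_eq`: along the orbit of `g` every `rename γ (eval g)` occurs).
* The sentence "the permanent of the adjacency matrix of a bipartite graph is exactly `μ(Γ)²`"
  (p. 19): `permanent_adjMatrix_of_isBipartiteWith` — for `G` bipartite on the parts `s, t`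
  covering the vertex set, `per (adjMatrix G) = (#perfect matchings of G)²` in any commutative
  semiring — via `card_perfectMatchings_eq_card_adjInvolutions` (perfect matchings ↔ adjacent
  involutions) and `card_adjPerms_eq_sq_of_isBipartiteWith` (permutations `σ` with `σ v ∼ v` ↔ pairs
  of adjacent involutions); and its reading on the tree's generic permanent `perPoly`
  (`eval_perPoly_adj_of_isBipartiteWith`), with the characteristic-`0` consequence used on p. 19
  (`eval_perPoly_adj_ne_of_card_perfectMatchings_ne`: different numbers of perfect matchings give
  different values of `PERM_n` at the adjacency matrices).
-/

noncomputable section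

namespace Literature.Computability.AlgebraicComplexity

open MvPolynomial

universe u v w z

namespace LabelledArithCircuit

variable {K : Type u} {X : Type v} {Y : Type z} {G : Type w}
variable {Γ : Type*} [Group Γ] [MulAction Γ X] [MulAction Γ Y]

/-! ### Automorphisms: identity, inverses, composition (Def. 3.6) -/

/-- The identity is an automorphism extending `1 ∈ Γ`. [cite: DawarWilsenach2025, Def. 3.6] -/
theorem isAutomorphismExtending_one (C : LabelledArithCircuit K X Y G) :
    C.IsAutomorphismExtending (1 : Γ) (1 : Equiv.Perm G) where
  children_apply g := by
    have he : (1 : Equiv.Perm G).toEmbedding = Function.Embedding.refl G := by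
      ext x
      rfl
    rw [Equiv.Perm.one_apply, he, Finset.map_refl]
  label_apply g := by rw [Equiv.Perm.one_apply, one_smul]
  output_smul y := by rw [Equiv.Perm.one_apply, one_smul]

/-- The inverse of an automorphism extending `γ` is an automorphism extending `γ⁻¹`.
[cite: DawarWilsenach2025, Def. 3.6] -/
theorem IsAutomorphismExtending.inv {C : LabelledArithCircuit K X Y G} {γ : Γ} {π : Equiv.Perm G}
    (h : C.IsAutomorphismExtending γ π) : C.IsAutomorphismExtending γ⁻¹ π⁻¹ := by
  refine ⟨fun g => ?_, fun g => ?_, fun y => ?_⟩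
  · have h1 := h.children_apply (π.symm g)
    rw [Equiv.apply_symm_apply] at h1
    ext k
    simp only [Equiv.Perm.inv_def, Finset.mem_map_equiv, Equiv.symm_symm]
    rw [h1, Finset.mem_map_equiv, Equiv.symm_apply_apply]
  · have h1 := h.label_apply (π.symm g)
    rw [Equiv.apply_symm_apply] at h1
    rw [Equiv.Perm.inv_def, eq_inv_smul_iff]
    exact h1.symm
  · have h1 := h.output_smul (γ⁻¹ • y)
    rw [smul_inv_smul] at h1
    rw [Equiv.Perm.inv_def, Equiv.eq_symm_apply]
    exact h1.symm

/-- Automorphisms compose: if `π` extends `γ` and `π'` extends `γ'` then `π' * π` extends `γ' * γ`.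
[cite: DawarWilsenach2025, Def. 3.6] -/
theorem IsAutomorphismExtending.trans {C : LabelledArithCircuit K X Y G} {γ γ' : Γ}
    {π π' : Equiv.Perm G} (h : C.IsAutomorphismExtending γ π) (h' : C.IsAutomorphismExtending γ' π') :
    C.IsAutomorphismExtending (γ' * γ) (π' * π) where
  children_apply g := by
    have he : π.toEmbedding.trans π'.toEmbedding = (π' * π).toEmbedding := by
      ext x
      rfl
    rw [Equiv.Perm.mul_apply, h'.children_apply, h.children_apply, Finset.map_map, he]
  label_apply g := by
    rw [Equiv.Perm.mul_apply, h'.label_apply, h.label_apply, mul_smul]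
  output_smul y := by
    rw [mul_smul, h'.output_smul, h.output_smul, Equiv.Perm.mul_apply]

/-! ### Orbits (§3.2) -/

/-- Membership in the orbit of a gate, unfolded. [cite: DawarWilsenach2025, §3.2 (Orb(g))] -/
theorem mem_autOrbit_iff (C : LabelledArithCircuit K X Y G) (Γ : Type*) [Group Γ] [MulAction Γ X]
    [MulAction Γ Y] (g h : G) :
    h ∈ C.autOrbit Γ g ↔ ∃ (γ : Γ) (π : Equiv.Perm G), C.IsAutomorphismExtending γ π ∧ π g = h :=
  Iff.rfl

/-- Every gate lies in its own orbit (the identity automorphism). [cite: DawarWilsenach2025, §3.2 (Orb(g))] -/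
theorem mem_autOrbit_self (C : LabelledArithCircuit K X Y G) (Γ : Type*) [Group Γ] [MulAction Γ X]
    [MulAction Γ Y] (g : G) : g ∈ C.autOrbit Γ g :=
  ⟨1, 1, C.isAutomorphismExtending_one, rfl⟩

/-- Orbit membership is symmetric (inverse automorphism). [cite: DawarWilsenach2025, §3.2 (Orb(g))] -/
theorem mem_autOrbit_comm (C : LabelledArithCircuit K X Y G) (Γ : Type*) [Group Γ] [MulAction Γ X]
    [MulAction Γ Y] (g h : G) : h ∈ C.autOrbit Γ g ↔ g ∈ C.autOrbit Γ h := by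
  constructor
  · rintro ⟨γ, π, hπ, rfl⟩
    exact ⟨γ⁻¹, π⁻¹, hπ.inv, by simp⟩
  · rintro ⟨γ, π, hπ, rfl⟩
    exact ⟨γ⁻¹, π⁻¹, hπ.inv, by simp⟩

/-- Orbit membership is transitive (composition of automorphisms). [cite: DawarWilsenach2025, §3.2 (Orb(g))] -/
theorem mem_autOrbit_trans (C : LabelledArithCircuit K X Y G) (Γ : Type*) [Group Γ] [MulAction Γ X]
    [MulAction Γ Y] {g h k : G} (hh : h ∈ C.autOrbit Γ g) (hk : k ∈ C.autOrbit Γ h) :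
    k ∈ C.autOrbit Γ g := by
  obtain ⟨γ, π, hπ, rfl⟩ := hh
  obtain ⟨γ', π', hπ', rfl⟩ := hk
  exact ⟨γ' * γ, π' * π, hπ.trans hπ', rfl⟩

/-- The orbit of every gate is bounded by the orbit size. [cite: DawarWilsenach2025, §3.2 (ORB(C))] -/
theorem ncard_autOrbit_le_orbitSize [Fintype G] (C : LabelledArithCircuit K X Y G) (Γ : Type*)
    [Group Γ] [MulAction Γ X] [MulAction Γ Y] (g : G) : (C.autOrbit Γ g).ncard ≤ C.orbitSize Γ :=
  Finset.le_sup (f := fun g => (C.autOrbit Γ g).ncard) (Finset.mem_univ g)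

/-- A circuit with a gate has orbit size at least `1`. [cite: DawarWilsenach2025, §3.2 (ORB(C))] -/
theorem one_le_orbitSize [Fintype G] [Nonempty G] (C : LabelledArithCircuit K X Y G) (Γ : Type*)
    [Group Γ] [MulAction Γ X] [MulAction Γ Y] : 1 ≤ C.orbitSize Γ := by
  obtain ⟨g⟩ := ‹Nonempty G›
  refine le_trans ?_ (C.ncard_autOrbit_le_orbitSize Γ g)
  rw [Nat.one_le_iff_ne_zero, Ne, Set.ncard_eq_zero (Set.toFinite _)]
  exact fun h => (Set.eq_empty_iff_forall_notMem.mp h) g (C.mem_autOrbit_self Γ g)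

/-! ### Symmetric circuits compute symmetric polynomials (remark after Def. 3.7) -/

section Eval

variable [CommSemiring K]

/-- **Automorphisms act on the computed polynomials by renaming** (Dawar–Wilsenach, remark after
Def. 3.7 and §3.3): if `π` is an automorphism extending `γ`, the polynomial at `π g` is the one at
`g` with the variables renamed by `γ`. Unbundled form of `SymmetricArithmeticCircuit.eval_smul`.
[cite: DawarWilsenach2025, §3.2 (after Def. 3.7)] -/
theorem IsAutomorphismExtending.eval_apply {C : LabelledArithCircuit K X Y G} {γ : Γ}
    {π : Equiv.Perm G} (h : C.IsAutomorphismExtending γ π) (g : G) :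
    C.eval (π g) = MvPolynomial.rename (fun x : X => γ • x) (C.eval g) := by
  induction g using C.wf.induction with
  | h g ih =>
    have hlab := h.label_apply g
    rcases hl : C.label g with x | c | _ | _
    · rw [hl, CircuitLabel.smul_var] at hlab
      rw [C.eval_of_label_var hl, C.eval_of_label_var hlab, rename_X]
    · rw [hl, CircuitLabel.smul_const] at hlab
      rw [C.eval_of_label_const hl, C.eval_of_label_const hlab, rename_C]
    · rw [hl, CircuitLabel.smul_add] at hlab
      rw [C.eval_of_label_add hl, C.eval_of_label_add hlab, map_sum, h.children_apply,
        Finset.sum_map]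
      refine Finset.sum_congr rfl fun k hk => ?_
      exact ih k hk
    · rw [hl, CircuitLabel.smul_mul] at hlab
      rw [C.eval_of_label_mul hl, C.eval_of_label_mul hlab, map_prod, h.children_apply,
        Finset.prod_map]
      refine Finset.prod_congr rfl fun k hk => ?_
      exact ih k hk

/-- Outputs are equivariant under an automorphism: `eval (output (γ • y)) = rename γ (eval (output y))`.
[cite: DawarWilsenach2025, §3.2 (after Def. 3.7)] -/
theorem IsAutomorphismExtending.eval_output_smul {C : LabelledArithCircuit K X Y G} {γ : Γ}
    {π : Equiv.Perm G} (h : C.IsAutomorphismExtending γ π) (y : Y) :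
    C.eval (C.output (γ • y)) = MvPolynomial.rename (fun x : X => γ • x) (C.eval (C.output y)) := by
  rw [h.output_smul, h.eval_apply]

/-- **A `Γ`-symmetric circuit computes a `Γ`-equivariant family of polynomials** ("if a circuit is
`Γ`-symmetric then it computes a `Γ`-symmetric polynomial"). [cite: DawarWilsenach2025, §3.2 (after Def. 3.7)] -/
theorem IsSymmetric.eval_output_smul {C : LabelledArithCircuit K X Y G} (hC : C.IsSymmetric Γ)
    (γ : Γ) (y : Y) :
    C.eval (C.output (γ • y)) = MvPolynomial.rename (fun x : X => γ • x) (C.eval (C.output y)) := by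
  obtain ⟨π, hπ⟩ := hC γ
  exact hπ.eval_output_smul y

/-- At an output index fixed by `γ` (e.g. the single output `Y = Unit` of Thm. 7.1) a `Γ`-symmetric
circuit computes a polynomial invariant under renaming by `γ`. [cite: DawarWilsenach2025, §3.2 (after Def. 3.7)] -/
theorem IsSymmetric.rename_eval_output {C : LabelledArithCircuit K X Y G} (hC : C.IsSymmetric Γ)
    (γ : Γ) {y : Y} (hy : γ • y = y) :
    MvPolynomial.rename (fun x : X => γ • x) (C.eval (C.output y)) = C.eval (C.output y) := by
  rw [← hC.eval_output_smul γ y, hy]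

/-- The single-output case `Y = Unit` (the setting of Thm. 7.1): the computed polynomial is
`Γ`-invariant. [cite: DawarWilsenach2025, §3.2 (after Def. 3.7)] -/
theorem IsSymmetric.rename_eval_output_unit {C : LabelledArithCircuit K X Unit G}
    (hC : C.IsSymmetric Γ) (γ : Γ) :
    MvPolynomial.rename (fun x : X => γ • x) (C.eval (C.output ())) = C.eval (C.output ()) :=
  hC.rename_eval_output γ (Subsingleton.elim _ _)

/-- Along the orbit of a gate `g` of a `Γ`-symmetric circuit every renaming `rename γ (eval g)`
occurs as the polynomial of some gate (so an orbit is at least as large as the `Γ`-orbit of the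
polynomial `eval g`). [cite: DawarWilsenach2025, §3.2 (Orb(g))] -/
theorem IsSymmetric.exists_mem_autOrbit_eval_eq {C : LabelledArithCircuit K X Y G}
    (hC : C.IsSymmetric Γ) (g : G) (γ : Γ) :
    ∃ h ∈ C.autOrbit Γ g, C.eval h = MvPolynomial.rename (fun x : X => γ • x) (C.eval g) := by
  obtain ⟨π, hπ⟩ := hC γ
  exact ⟨π g, ⟨γ, π, hπ, rfl⟩, hπ.eval_apply g⟩

end Eval

end LabelledArithCircuit

/-! ### The permanent of the adjacency matrix of a bipartite graph (proof of Thm. 7.1, p. 19) -/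

section Permanent

open SimpleGraph Finset

variable {V : Type*}

/-- **Perfect matchings are adjacent involutions**: the perfect matchings of `G` are in bijection
with the permutations `τ` of the vertices with `v ∼ τ v` and `τ (τ v) = v` for all `v` (the partner
map), so both sets have the same cardinality. [folklore] -/
theorem card_perfectMatchings_eq_card_adjInvolutions (G : SimpleGraph V) :
    Nat.card {M : G.Subgraph // M.IsPerfectMatching} =
      Nat.card {τ : Equiv.Perm V // ∀ v, G.Adj v (τ v) ∧ τ (τ v) = v} := by
  classical
  -- the partner map of a perfect matching
  have hex : ∀ M : {M : G.Subgraph // M.IsPerfectMatching}, ∀ v, ∃! w, M.1.Adj v w := fun M =>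
    Subgraph.isPerfectMatching_iff.mp M.2
  let p : {M : G.Subgraph // M.IsPerfectMatching} → V → V := fun M v => (hex M v).exists.choose
  have hp : ∀ (M : {M : G.Subgraph // M.IsPerfectMatching}) (v : V), M.1.Adj v (p M v) := fun M v =>
    (hex M v).exists.choose_spec
  have hp_eq : ∀ (M : {M : G.Subgraph // M.IsPerfectMatching}) (v w : V), M.1.Adj v w → p M v = w :=
    fun M v w hvw => (hex M v).unique (hp M v) hvw
  have hpp : ∀ M : {M : G.Subgraph // M.IsPerfectMatching}, Function.Involutive (p M) := fun M v =>
    hp_eq M _ _ (M.1.adj_symm (hp M v))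
  -- the matching of an adjacent involution
  let S : {τ : Equiv.Perm V // ∀ v, G.Adj v (τ v) ∧ τ (τ v) = v} → G.Subgraph := fun τ =>
    { verts := Set.univ
      Adj := fun v w => τ.1 v = w
      adj_sub := by
        rintro v w rfl
        exact (τ.2 v).1
      edge_vert := fun _ => Set.mem_univ _
      symm := ⟨fun v w h => by rw [← h]; exact (τ.2 v).2⟩ }
  have hS : ∀ τ, (S τ).IsPerfectMatching := fun τ =>
    Subgraph.isPerfectMatching_iff.mpr fun v => ⟨τ.1 v, rfl, fun w hw => (show τ.1 v = w from hw).symm⟩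
  refine Nat.card_congr
    { toFun := fun M => ⟨Function.Involutive.toPerm (p M) (hpp M), fun v =>
        ⟨M.1.adj_sub (hp M v), hpp M v⟩⟩
      invFun := fun τ => ⟨S τ, hS τ⟩
      left_inv := ?_
      right_inv := ?_ }
  · intro M
    apply Subtype.ext
    ext v w
    · simp only [S, Set.mem_univ, true_iff]
      exact M.2.2 v
    · change p M v = w ↔ M.1.Adj v w
      exact ⟨fun h => h ▸ hp M v, hp_eq M v w⟩
  · intro τ
    apply Subtype.ext
    ext v
    change p ⟨S τ, hS τ⟩ v = τ.1 v
    exact hp_eq ⟨S τ, hS τ⟩ v (τ.1 v) (show τ.1 v = τ.1 v from rfl)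

/-- In a bipartite graph on the parts `s, t` covering the vertex set, the two ends of an edge lie
on opposite sides: `v ∈ s ↔ w ∉ s`. [folklore] -/
theorem mem_iff_not_mem_of_isBipartiteWith_adj {G : SimpleGraph V} {s t : Set V}
    (hG : G.IsBipartiteWith s t) (hst : s ∪ t = Set.univ) {a b : V} (hab : G.Adj a b) :
    a ∈ s ↔ b ∉ s := by
  have hcov : ∀ x, x ∈ s ∨ x ∈ t := fun x => by
    have : x ∈ s ∪ t := hst ▸ Set.mem_univ x
    exact this
  have hdis : ∀ x, x ∈ s → x ∈ t → False := fun x hs ht =>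
    Set.disjoint_left.mp hG.disjoint hs ht
  rcases hG.mem_of_adj hab with ⟨ha, hb⟩ | ⟨ha, hb⟩
  · exact ⟨fun _ hbs => hdis b hbs hb, fun _ => ha⟩
  · constructor
    · exact fun has => (hdis a has ha).elim
    · intro hbs
      exact ((hcov b).resolve_right fun hbt => hdis b hb hbt) |> fun h => (hbs h).elim

/-- **Permutations along edges of a bipartite graph are pairs of perfect matchings**: for `G`
bipartite on the parts `s, t` covering the vertex set, the permutations `σ` with `σ v ∼ v` for all
`v` are in bijection with pairs of adjacent involutions (`σ ↦ (σ on s ∪ σ⁻¹ on t, σ⁻¹ on s ∪ σ on t)`),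
so their number is the square of the number of perfect matchings. [folklore] -/
theorem card_adjPerms_eq_sq_of_isBipartiteWith (G : SimpleGraph V) {s t : Set V}
    (hG : G.IsBipartiteWith s t) (hst : s ∪ t = Set.univ) :
    Nat.card {σ : Equiv.Perm V // ∀ v, G.Adj (σ v) v} =
      Nat.card {τ : Equiv.Perm V // ∀ v, G.Adj v (τ v) ∧ τ (τ v) = v} ^ 2 := by
  classical
  have side : ∀ {a b : V}, G.Adj a b → (a ∈ s ↔ b ∉ s) := fun hab =>
    mem_iff_not_mem_of_isBipartiteWith_adj hG hst hab
  rw [sq, ← Nat.card_prod]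
  -- forward maps
  let τ₁ : {σ : Equiv.Perm V // ∀ v, G.Adj (σ v) v} → V → V := fun σ v =>
    if v ∈ s then σ.1 v else σ.1.symm v
  let τ₂ : {σ : Equiv.Perm V // ∀ v, G.Adj (σ v) v} → V → V := fun σ v =>
    if v ∈ s then σ.1.symm v else σ.1 v
  have hσadj : ∀ (σ : {σ : Equiv.Perm V // ∀ v, G.Adj (σ v) v}) (v : V), G.Adj v (σ.1 v) :=
    fun σ v => (σ.2 v).symm
  have hσadj' : ∀ (σ : {σ : Equiv.Perm V // ∀ v, G.Adj (σ v) v}) (v : V), G.Adj v (σ.1.symm v) :=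
    fun σ v => by simpa using σ.2 (σ.1.symm v)
  have hτ₁ : ∀ σ v, G.Adj v (τ₁ σ v) ∧ τ₁ σ (τ₁ σ v) = v := by
    intro σ v
    by_cases hv : v ∈ s
    · have h1 : σ.1 v ∉ s := (side (hσadj σ v)).mp hv
      simp only [τ₁, hv, if_true, h1, if_false, Equiv.symm_apply_apply]
      exact ⟨hσadj σ v, trivial⟩
    · have h1 : σ.1.symm v ∈ s := by
        have := (side (hσadj' σ v)).not.mp ?_
        · simpa using this
        · exact hv
      simp only [τ₁, hv, if_false, h1, if_true, Equiv.apply_symm_apply]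
      exact ⟨hσadj' σ v, trivial⟩
  have hτ₂ : ∀ σ v, G.Adj v (τ₂ σ v) ∧ τ₂ σ (τ₂ σ v) = v := by
    intro σ v
    by_cases hv : v ∈ s
    · have h1 : σ.1.symm v ∉ s := (side (hσadj' σ v)).mp hv
      simp only [τ₂, hv, if_true, h1, if_false, Equiv.apply_symm_apply]
      exact ⟨hσadj' σ v, trivial⟩
    · have h1 : σ.1 v ∈ s := by
        have := (side (hσadj σ v)).not.mp hv
        simpa using this
      simp only [τ₂, hv, if_false, h1, if_true, Equiv.symm_apply_apply]
      exact ⟨hσadj σ v, trivial⟩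
  -- backward map
  let P : Equiv.Perm V → Prop := fun τ => ∀ v, G.Adj v (τ v) ∧ τ (τ v) = v
  let g : {τ : Equiv.Perm V // P τ} × {τ : Equiv.Perm V // P τ} → V → V := fun τ v =>
    if v ∈ s then τ.1.1 v else τ.2.1 v
  let g' : {τ : Equiv.Perm V // P τ} × {τ : Equiv.Perm V // P τ} → V → V := fun τ v =>
    if v ∈ s then τ.2.1 v else τ.1.1 v
  have hgg' : ∀ τ v, g τ (g' τ v) = v := by
    intro τ v
    by_cases hv : v ∈ s
    · have h1 : τ.2.1 v ∉ s := (side (τ.2.2 v).1).mp hv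
      simp only [g, g', hv, if_true, h1, if_false]
      exact (τ.2.2 v).2
    · have h1 : τ.1.1 v ∈ s := by
        have := (side (τ.1.2 v).1).not.mp hv
        simpa using this
      simp only [g, g', hv, if_false, h1, if_true]
      exact (τ.1.2 v).2
  have hg'g : ∀ τ v, g' τ (g τ v) = v := by
    intro τ v
    by_cases hv : v ∈ s
    · have h1 : τ.1.1 v ∉ s := (side (τ.1.2 v).1).mp hv
      simp only [g, g', hv, if_true, h1, if_false]
      exact (τ.1.2 v).2
    · have h1 : τ.2.1 v ∈ s := by
        have := (side (τ.2.2 v).1).not.mp hv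
        simpa using this
      simp only [g, g', hv, if_false, h1, if_true]
      exact (τ.2.2 v).2
  have hgadj : ∀ τ v, G.Adj (g τ v) v := by
    intro τ v
    by_cases hv : v ∈ s
    · simp only [g, hv, if_true]
      exact (τ.1.2 v).1.symm
    · simp only [g, hv, if_false]
      exact (τ.2.2 v).1.symm
  refine Nat.card_congr
    { toFun := fun σ =>
        (⟨Function.Involutive.toPerm (τ₁ σ) fun v => (hτ₁ σ v).2, hτ₁ σ⟩,
         ⟨Function.Involutive.toPerm (τ₂ σ) fun v => (hτ₂ σ v).2, hτ₂ σ⟩)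
      invFun := fun τ => ⟨⟨g τ, g' τ, hg'g τ, hgg' τ⟩, hgadj τ⟩
      left_inv := ?_
      right_inv := ?_ }
  · intro σ
    apply Subtype.ext
    ext v
    change g _ v = σ.1 v
    by_cases hv : v ∈ s
    · simp [g, τ₁, hv]
    · simp [g, τ₂, hv]
  · intro τ
    apply Prod.ext
    · apply Subtype.ext
      ext v
      change τ₁ ⟨⟨g τ, g' τ, hg'g τ, hgg' τ⟩, hgadj τ⟩ v = τ.1.1 v
      by_cases hv : v ∈ s
      · simp [τ₁, g, hv]
      · simp [τ₁, g', hv]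
    · apply Subtype.ext
      ext v
      change τ₂ ⟨⟨g τ, g' τ, hg'g τ, hgg' τ⟩, hgadj τ⟩ v = τ.2.1 v
      by_cases hv : v ∈ s
      · simp [τ₂, g', hv]
      · simp [τ₂, g, hv]

variable [Fintype V] [DecidableEq V]

/-- The permanent of the adjacency matrix counts the permutations along edges:
`per (adjMatrix G) = #{σ : σ v ∼ v for all v}`. [folklore] -/
theorem permanent_adjMatrix_eq_card (G : SimpleGraph V) [DecidableRel G.Adj] (R : Type*)
    [CommSemiring R] :
    (G.adjMatrix R).permanent = (Nat.card {σ : Equiv.Perm V // ∀ v, G.Adj (σ v) v} : R) := by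
  classical
  unfold Matrix.permanent
  simp_rw [SimpleGraph.adjMatrix_apply]
  rw [Nat.card_eq_fintype_card, Fintype.card_subtype]
  simp_rw [Fintype.prod_boole]
  rw [Finset.sum_boole]

/-- **"The permanent of the adjacency matrix of a bipartite graph is exactly `μ(Γ)²`"**
(Dawar–Wilsenach, proof of Thm. 7.1, p. 19; `μ(Γ)` = the number of perfect matchings): for `G`
bipartite on parts `s, t` covering the vertex set and any commutative semiring `R`,
`per (adjMatrix_R G) = (#perfect matchings of G)²`. [cite: DawarWilsenach2025, §7.1 (proof of Thm. 7.1, p. 19)] -/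
theorem permanent_adjMatrix_of_isBipartiteWith (G : SimpleGraph V) [DecidableRel G.Adj] {s t : Set V}
    (hG : G.IsBipartiteWith s t) (hst : s ∪ t = Set.univ) (R : Type*) [CommSemiring R] :
    (G.adjMatrix R).permanent =
      ((Nat.card {M : G.Subgraph // M.IsPerfectMatching} ^ 2 : ℕ) : R) := by
  rw [permanent_adjMatrix_eq_card, card_adjPerms_eq_sq_of_isBipartiteWith G hG hst,
    card_perfectMatchings_eq_card_adjInvolutions]

/-- The same on the tree's generic permanent `PERM = perPoly`: evaluating `perPoly V R` at the
`0/1` adjacency matrix of a bipartite graph gives the square of its number of perfect matchings.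
[cite: DawarWilsenach2025, §7.1 (proof of Thm. 7.1, p. 19)] -/
theorem eval_perPoly_adj_of_isBipartiteWith (G : SimpleGraph V) [DecidableRel G.Adj] {s t : Set V}
    (hG : G.IsBipartiteWith s t) (hst : s ∪ t = Set.univ) (R : Type*) [CommSemiring R] :
    MvPolynomial.eval (fun ij : V × V => if G.Adj ij.1 ij.2 then (1 : R) else 0) (perPoly V R) =
      ((Nat.card {M : G.Subgraph // M.IsPerfectMatching} ^ 2 : ℕ) : R) := by
  rw [eval_perPoly]
  have h : (Matrix.of fun i j : V => if G.Adj (i, j).1 (i, j).2 then (1 : R) else 0) =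
      G.adjMatrix R := by
    ext i j
    simp [SimpleGraph.adjMatrix_apply]
  rw [h, permanent_adjMatrix_of_isBipartiteWith G hG hst R]

/-- **The characteristic-`0` consequence used on p. 19**: bipartite graphs with different numbers
of perfect matchings (`μ(X) ≠ μ(Y)`, "and hence `μ(X)² ≠ μ(Y)²`") give different values of `PERM`
at their adjacency matrices over any commutative semiring of characteristic zero.
[cite: DawarWilsenach2025, §7.1 (proof of Thm. 7.1, p. 19)] -/
theorem eval_perPoly_adj_ne_of_card_perfectMatchings_ne {G H : SimpleGraph V} [DecidableRel G.Adj]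
    [DecidableRel H.Adj] {s t s' t' : Set V} (hG : G.IsBipartiteWith s t) (hst : s ∪ t = Set.univ)
    (hH : H.IsBipartiteWith s' t') (hst' : s' ∪ t' = Set.univ) (R : Type*) [CommSemiring R]
    [CharZero R]
    (hne : Nat.card {M : G.Subgraph // M.IsPerfectMatching} ≠
      Nat.card {M : H.Subgraph // M.IsPerfectMatching}) :
    MvPolynomial.eval (fun ij : V × V => if G.Adj ij.1 ij.2 then (1 : R) else 0) (perPoly V R) ≠
      MvPolynomial.eval (fun ij : V × V => if H.Adj ij.1 ij.2 then (1 : R) else 0) (perPoly V R) := by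
  rw [eval_perPoly_adj_of_isBipartiteWith G hG hst, eval_perPoly_adj_of_isBipartiteWith H hH hst']
  intro h
  apply hne
  have h2 := Nat.cast_injective (R := R) h
  exact Nat.pow_left_injective (by norm_num) h2

end Permanent

/-! ### Proof of Theorem 7.1 from Theorems 5.1, 6.4 and 7.2 (p. 19)

"Proof of Theorem 7.1. By Theorem 7.2, we have, for each `k`, a pair of graphs `X` and `Y` with
`O(k)` vertices such that `X ≡^k Y` and `μ(X) ≠ μ(Y)` and hence `μ(X)² ≠ μ(Y)²`. Thus, the
counting width of `μ²` is `Ω(n)`. Suppose that there is a family of square-symmetric arithmetic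
circuits over a field of characteristic `0` with orbit size `2^{o(n)}` computing `{PERM_n}`. Then,
since the permanent of the adjacency matrix of a bipartite graph is exactly `μ(Γ)²`, it follows
from Corollary 6.5 that the counting width of `μ²` is `o(n)`, giving a contradiction." (p. 19),
where Corollary 6.5 is Theorem 5.1 (the orbit-size preserving translation of symmetric arithmetic
circuits into symmetric threshold circuits) followed by Theorem 6.4. The theorem below is exactly
this deduction, with the three ingredients as hypotheses: Theorem 6.4 is the tree's named fact
`Literature.ModelTheory.FiniteModelTheory.DawarWilsenach2025_orbitSize_countingWidth`; Theorems 5.1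
and 7.2 are not in the tree and enter as explicit hypotheses in the (weakest) form the deduction
consumes — Thm. 5.1 for families, with "orbit size `2^{o(n)}`" preserved (the printed theorem gives
`ORB(Ψ) = ORB(Φ)` circuit by circuit) and the Boolean circuit deciding `Φ[A] ∈ S_n` on `0/1`
inputs, in the vocabulary of the Thm. 6.4 fact (straight-line `tcBasis` circuits, simply wired,
`Sym_n`-symmetric); Thm. 7.2 with `≡^k` read as the tree's `CkEquiv k` (`k` pebble pairs; the
printed `≡^k` is `k`-dimensional Weisfeiler–Leman, i.e. `C^{k+1}`, which is finer) and "`O(k)`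
vertices" as `m ≤ c·k + c`. Relative sizes: `k < m` is derived (non-isomorphic `≡^k` graphs have
more than `k` vertices, `CkEquiv.nonempty_iso` and the isomorphism invariance of the number of
perfect matchings, `Literature.Probability.LatticeModels.card_perfectMatchings_eq_of_iso`).
The set `S_n` of Cor. 6.5 is taken to be the single value `PERM(X_{k(n)})` for ONE index `k(n)`
with `|X_{k(n)}| = n` (the printed "`S = {μ(Γ_n) : n ∈ ℕ}`" would not separate `Γ_n` from `Δ_n`). -/

section Reduction

open Filter
open Literature.ModelTheory.FiniteModelTheory
open Literature.Computability.Complexity (Circuit tcBasis)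

/-- **Dawar–Wilsenach, proof of Theorem 7.1 (p. 19): Theorem 7.1 follows from Theorem 5.1
(arithmetic-to-threshold translation preserving symmetry and orbit size `2^{o(n)}`, here for
families of square-symmetric circuits on the `n × n` variable matrix and finite target sets
`S_n ⊆ F`), Theorem 6.4 (the named fact `DawarWilsenach2025_orbitSize_countingWidth`) and
Theorem 7.2 (for every `k`, `C^k`-equivalent bipartite graphs on `m ≤ c·k + c` common vertices with
different numbers of perfect matchings).** The deduction is the printed one: in characteristic
`0` the two graphs of Thm. 7.2 have different values of `PERM` at their adjacency matrices
(`eval_perPoly_adj_ne_of_card_perfectMatchings_ne`), so the class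
`𝒞 = {Γ : PERM(Γ) = PERM(X_{k(n)})}` decided (Thm. 5.1) by symmetric threshold circuits of orbit
size `2^{o(n)}` is not `≡^{C^k}`-invariant at order `m = |X_k|` with `k ≥ m/(2c+2)`, against
Thm. 6.4. [cite: DawarWilsenach2025, §7.1 (proof of Thm. 7.1, p. 19)] -/
theorem DawarWilsenach2025_thm71_of_thm51_thm64_thm72
    (h51 : ∀ (F : Type) [Field F] [CharZero F] (G : ℕ → Type) [∀ n, Fintype (G n)]
      (Φ : ∀ n, LabelledArithCircuit F (Fin n × Fin n) Unit (G n)) (S : ℕ → Set F),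
      (∀ n, (Φ n).IsSymmetric (Equiv.Perm (Fin n))) → (∀ n, (S n).Finite) →
      (∀ ε : ℝ, 0 < ε → ∀ᶠ n : ℕ in atTop,
        ((Φ n).orbitSize (Equiv.Perm (Fin n)) : ℝ) ≤ (2 : ℝ) ^ (ε * (n : ℝ))) →
      ∃ Ψ : ∀ n, Circuit (Fin n × Fin n),
        (∀ n, (Ψ n).IsOver tcBasis ∧ (Ψ n).IsSymmetricUnder Set.univ ∧ (Ψ n).HasSimpleWiring) ∧
        (∀ ε : ℝ, 0 < ε → ∀ᶠ n : ℕ in atTop,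
          ((Ψ n).orbitSize Set.univ : ℝ) ≤ (2 : ℝ) ^ (ε * (n : ℝ))) ∧
        ∀ (n : ℕ) (A : Fin n × Fin n → Bool), (Ψ n).eval A = true ↔
          MvPolynomial.eval (fun ij => if A ij = true then (1 : F) else 0)
            ((Φ n).eval ((Φ n).output ())) ∈ S n)
    (h64 : DawarWilsenach2025_orbitSize_countingWidth)
    (h72 : ∃ c : ℕ, ∀ k : ℕ, ∃ m : ℕ, m ≤ c * k + c ∧ ∃ X Y : SimpleGraph (Fin m),
      (∃ s t : Set (Fin m), X.IsBipartiteWith s t ∧ s ∪ t = Set.univ) ∧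
      (∃ s t : Set (Fin m), Y.IsBipartiteWith s t ∧ s ∪ t = Set.univ) ∧
      CkEquiv k X Y ∧
      Nat.card {M : X.Subgraph // M.IsPerfectMatching} ≠
        Nat.card {M : Y.Subgraph // M.IsPerfectMatching}) :
    DawarWilsenach2025_thm71 := by
  intro F _ _ G _ C hsym hper
  classical
  by_contra hcon
  -- orbit size `2^{o(n)}`
  have hsmall : ∀ ε : ℝ, 0 < ε → ∀ᶠ n : ℕ in atTop,
      ((C n).orbitSize (Equiv.Perm (Fin n)) : ℝ) ≤ (2 : ℝ) ^ (ε * (n : ℝ)) := by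
    intro ε hε
    have h2 : ¬ ∃ᶠ n : ℕ in atTop,
        (2 : ℝ) ^ (ε * (n : ℝ)) ≤ ((C n).orbitSize (Equiv.Perm (Fin n)) : ℝ) :=
      fun h => hcon ⟨ε, hε, h⟩
    rw [Filter.not_frequently] at h2
    exact h2.mono fun n hn => le_of_lt (not_le.mp hn)
  -- the graphs of Theorem 7.2
  obtain ⟨c, hc⟩ := h72
  choose m hm X Y hXb hYb hXY hpm using hc
  -- Boolean adjacency matrices and the value of `PERM` at them
  let adjB : ∀ n, SimpleGraph (Fin n) → Fin n × Fin n → Bool := fun n Γ ij =>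
    decide (Γ.Adj ij.1 ij.2)
  let val : ∀ n, (Fin n × Fin n → Bool) → F := fun n A =>
    MvPolynomial.eval (fun ij => if A ij = true then (1 : F) else 0) (perPoly (Fin n) F)
  have hval : ∀ (n : ℕ) (Γ : SimpleGraph (Fin n)), val n (adjB n Γ) =
      MvPolynomial.eval (fun ij : Fin n × Fin n => if Γ.Adj ij.1 ij.2 then (1 : F) else 0)
        (perPoly (Fin n) F) := by
    intro n Γ
    have hfun : (fun ij : Fin n × Fin n => if decide (Γ.Adj ij.1 ij.2) = true then (1 : F) else 0) =
        fun ij => if Γ.Adj ij.1 ij.2 then (1 : F) else 0 := by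
      funext ij
      by_cases h : Γ.Adj ij.1 ij.2 <;> simp [h]
    simp only [val, adjB]
    rw [hfun]
  -- in characteristic `0` the two graphs have different `PERM` values ...
  have hne : ∀ k, val (m k) (adjB (m k) (X k)) ≠ val (m k) (adjB (m k) (Y k)) := by
    intro k
    obtain ⟨s, t, hs, hst⟩ := hXb k
    obtain ⟨s', t', hs', hst'⟩ := hYb k
    rw [hval, hval]
    exact eval_perPoly_adj_ne_of_card_perfectMatchings_ne hs hst hs' hst' F (hpm k)
  -- ... hence are not isomorphic, so `k < m k`
  have hkm : ∀ k, k < m k := by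
    intro k
    by_contra hk
    have hk' : m k ≤ k := not_lt.mp hk
    apply hpm k
    rcases Nat.eq_zero_or_pos (m k) with h0 | hpos
    · have hXYeq : X k = Y k := by
        ext a b
        exact absurd a.isLt (by omega)
      rw [hXYeq]
    · rcases Nat.eq_zero_or_pos k with hk0 | hkpos
      · omega
      · obtain ⟨e⟩ := (hXY k).nonempty_iso hkpos (by simpa using hk')
        exact Literature.Probability.LatticeModels.card_perfectMatchings_eq_of_iso e
  -- one index `k(n)` with `m (k(n)) = n` whenever there is one; the sets `S_n`; the class `𝒞`
  let ksel : ℕ → ℕ := fun n => if h : ∃ k, m k = n then h.choose else 0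
  have hksel : ∀ k, m (ksel (m k)) = m k := by
    intro k
    have h : ∃ k', m k' = m k := ⟨k, rfl⟩
    simp only [ksel, dif_pos h]
    exact h.choose_spec
  let S : ℕ → Set F := fun n => {val (m (ksel n)) (adjB (m (ksel n)) (X (ksel n)))}
  have hSfin : ∀ n, (S n).Finite := fun n => Set.finite_singleton _
  let 𝒞 : Set FinGraph := {Γ | val Γ.1 (adjB Γ.1 Γ.2) ∈ S Γ.1}
  -- Theorem 5.1: symmetric threshold circuits of orbit size `2^{o(n)}` deciding `𝒞`
  obtain ⟨Ψ, hΨ, hΨorb, hΨeval⟩ := h51 F G C S hsym hSfin hsmall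
  have hdec : DecidesGraphClass 𝒞 Ψ := by
    intro n Γ _
    rw [hΨeval n (adjInput Γ), hper n]
    have hA : adjInput Γ = adjB n Γ := by
      funext ij
      simp [adjInput_apply, adjB]
    rw [hA]
    exact Iff.rfl
  -- Theorem 6.4 with `ε = 1 / (2c + 2)`
  set ε : ℝ := 1 / (2 * (c : ℝ) + 2) with hε_def
  have hε : 0 < ε := by positivity
  have hinv := h64 𝒞 Ψ hΨ hdec hΨorb ε hε
  rw [Filter.eventually_atTop] at hinv
  obtain ⟨N, hN⟩ := hinv
  -- a large order of the form `m k'` with `k'` the selected index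
  set k₀ : ℕ := N + c + 1 with hk₀_def
  set k' : ℕ := ksel (m k₀) with hk'_def
  have hmk' : m k' = m k₀ := hksel k₀
  have hk₀m : k₀ < m k₀ := hkm k₀
  have hn_ge : N ≤ m k' := by
    rw [hmk']
    omega
  have hεk : ε * ((m k' : ℕ) : ℝ) ≤ (k' : ℝ) := by
    have h1 : m k' ≤ c * k' + c := hm k'
    have hk'1 : 1 ≤ k' := by
      by_contra h0
      have hz : k' = 0 := by omega
      have h1' : m k' ≤ c := by
        calc m k' ≤ c * k' + c := h1
          _ = c := by rw [hz, mul_zero, zero_add]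
      omega
    have h1' : ((m k' : ℕ) : ℝ) ≤ (c : ℝ) * (k' : ℝ) + (c : ℝ) := by exact_mod_cast h1
    have hk1' : (1 : ℝ) ≤ (k' : ℝ) := by exact_mod_cast hk'1
    have hc0 : (0 : ℝ) ≤ (c : ℝ) := Nat.cast_nonneg c
    have h2 : ((m k' : ℕ) : ℝ) ≤ (2 * (c : ℝ) + 2) * (k' : ℝ) := by
      nlinarith [mul_nonneg hc0 (sub_nonneg.mpr hk1')]
    rw [hε_def, one_div, inv_mul_le_iff₀ (by positivity)]
    exact h2
  have hI : IsCkInvariantAt 𝒞 (m k') k' := hN (m k') hn_ge k' hεk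
  have hsel : ksel (m k') = k' := by
    rw [hmk']
  have hX : (⟨m k', X k'⟩ : FinGraph) ∈ 𝒞 := by
    show val (m k') (adjB (m k') (X k')) ∈ S (m k')
    simp only [S, Set.mem_singleton_iff]
    rw [hsel]
  have hY : (⟨m k', Y k'⟩ : FinGraph) ∉ 𝒞 := by
    show val (m k') (adjB (m k') (Y k')) ∉ S (m k')
    simp only [S, Set.mem_singleton_iff]
    rw [hsel]
    exact (hne k').symm
  exact hY ((hI (X k') (Y k') (hXY k')).mp hX)

end Reduction

end Literature.Computability.AlgebraicComplexity

end
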